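import Literature.MathematicalPhysics.QuantumFieldTheory.Balaban1983to89.B3CxiPropagator
import Mathlib.MeasureTheory.Constructions.HaarToSphere

/-!
# `Balaban1983to89.B3CxiTadpole` — the free tadpole C^ξ(0) on ξℤ^d: O(ξ^{−1}) in d = 3, O(log ξ^{−1}) in d = 2

statement-level skeleton of published theorems with citation tags; proofs where landed; nothing here is a claim about the Yang–Mills mass gap

Sources.  T. Bałaban, J. Imbrie, A. Jaffe, *Renormalization of the Higgs model: minimizers, propagators and the
stability of mean field theory*, Commun. Math. Phys. **97** (1985) 299–329 [BalabanImbrieJaffe1985], p. 300 [PDF 2],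
(1.2)–(1.3), verbatim: *"P(ξ) = λ(ε)|ξ|⁴ − ¼(m² + δm²)ε²|ξ|², (1.2) where λ(ε) = λε^{4−d}. The mass shift is consistent
with perturbation theory with δm²(ε) = O(ln ε^{−1}) (d = 2), O(ε^{−1}) (d = 3). (1.3)"*; and T. Bałaban, *(Higgs)₂,₃
quantum fields in a finite volume. III. Renormalization*, Commun. Math. Phys. **88** (1983) 411–445 [Balaban1983Higgs3],
p. 437 [PDF 27], (3.16): the free propagator *"C^ξ = (−Δ^ξ + 1)^{−1}"* on the ξ-lattice (typed as its momentum integral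
`B3Sect3VectorSelfEnergy.Cxi`, kernel with respect to Σ_{y′}ξ^d; nonnegative and of unit mass, `B3CxiPropagator`).

What the printed order-of-magnitude claim (1.3) rests on.  The perturbative mass shift begins, at one loop, with the
tadpole graphs ((1.7) of [Balaban1983Higgs3]; degree 2 − d by the power counting of Cor. 2.3, kernel-checked as
`B3Cor23ConcreteProof.tadpole17_deg`): a coupling constant times the free lattice propagator AT COINCIDING POINTS.  On the
lattice of spacing ξ with unit mass that number is C^ξ(0); the ε-lattice propagator of mass m is m^{d−2}C^{mε} after
scaling, so "O(ε^{−1}) (d = 3), O(ln ε^{−1}) (d = 2)" for the one-loop term is the statement that C^ξ(0) = O(ξ^{−1}) in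
d = 3 and O(log ξ^{−1}) in d = 2 as ξ → 0.  THIS is what the present file proves, with explicit constants:

* `Cxi_zero_eq` — the tadpole in rescaled form, C^ξ(0) = (2π)^{−d}ξ^{2−d}∫_{|q|≤π} dq/(Δ¹(q) + ξ²) (the change of variables
  p = q/ξ of (3.24)/(3.28), `B3Sect3VectorSelfEnergy.integral_bzBox_comp_smul`, and Δ^ξ(p) = ξ^{−2}Δ¹(ξp));
* `norm_sq_le_lapSymbol` — Jordan's inequality in the form Δ¹(q) ≥ (4/π²)‖q‖²_∞ on the Brillouin box max_μ|q_μ| ≤ π;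
* `boxIntegral_le_radial` — the radial majorant ∫_{|q|≤π} dq/(Δ¹(q)+ξ²) ≤ d·2^d·∫₀^{π+1} y^{d−1}dy/((4/π²)y² + ξ²)
  (box ⊆ sup-norm ball of radius π + 1; Mathlib's `MeasureTheory.integral_fun_norm_addHaar`, the sup-norm unit ball of ℝ^d
  having volume 2^d) — no singular integrand is ever integrated, the one-dimensional integrand being bounded;
* **`Cxi_zero_le_three`** — d = 3: **C^ξ(0) ≤ (3(π+1)/(4π))·ξ^{−1}** for every ξ > 0 (and C^ξ(0) ≥ 0, `B3CxiPropagator.Cxi_nonneg`);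
* **`Cxi_zero_le_two`** — d = 2: **C^ξ(0) ≤ ¼·log(1 + 4(π+1)²/(π²ξ²))** for every ξ > 0 (the one-dimensional integral in
  closed form by the fundamental theorem of calculus, primitive (π²/8)log((4/π²)y² + ξ²)), whence
  **`Cxi_zero_le_two_log`**: C^ξ(0) ≤ ¼log(1 + 4(π+1)²/π²) + ½log ξ^{−1} for 0 < ξ ≤ 1;
* `tadpole_bigO_three`, `tadpole_bigO_two` — the O-forms as printed in (1.3): ∃K ∀ξ>0, C^ξ(0) ≤ Kξ^{−1} (d = 3);
  ∃A B ∀ξ∈(0,1], C^ξ(0) ≤ A + B log ξ^{−1} (d = 2).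

Typing notes.  T1: "O(·)" in (1.3) is an upper bound as ε → 0; lower bounds of the same order hold (C^ξ(0) → (2π)^{−3}∫dq/Δ¹(q)·ξ^{−1}
in d = 3) but are neither printed nor proved here.  T2: the statement is made for the unit-mass free propagator C^ξ of (3.16);
the full δm² of the (Higgs)₂,₃ papers ((1.29) of [Balaban1983Higgs3], `B3Sect1Counterterms.dm2Total`) contains further
(two-loop, d = 3) terms whose logarithmic size is not addressed here.  NOTHING beyond the kernel-checked statements below is
asserted; in particular nothing about the non-perturbative mass shift.
-/

noncomputable section

namespace Literature.MathematicalPhysics.QuantumFieldTheory.Balaban1983to89.B3CxiTadpole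

open MeasureTheory Metric Set B3Sect3VectorSelfEnergy B3CxiPropagator

variable {d : ℕ} {ξ : ℝ}

/-! ## 1. The tadpole in rescaled form -/

/-- kernel: the Brillouin box as a product of compact intervals. [folklore] -/
private theorem bzBox_eq_pi' (d : ℕ) (ξ : ℝ) :
    bzBox d ξ = Set.univ.pi fun _ : Fin d => Set.Icc (-(Real.pi / ξ)) (Real.pi / ξ) := by
  ext p
  simp only [bzBox, Set.mem_setOf_eq, Set.mem_univ_pi, Set.mem_Icc, abs_le]

/-- kernel: the Brillouin box is compact. [folklore] -/
private theorem isCompact_bzBox' (d : ℕ) (ξ : ℝ) : IsCompact (bzBox d ξ) := by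
  rw [bzBox_eq_pi']
  exact isCompact_univ_pi fun _ => isCompact_Icc

/-- kernel: the Brillouin box is measurable. [folklore] -/
private theorem measurableSet_bzBox' (d : ℕ) (ξ : ℝ) : MeasurableSet (bzBox d ξ) :=
  (isCompact_bzBox' d ξ).isClosed.measurableSet

/-- kernel: Δ¹ at ξ = 1 is Σ_μ(2 − 2cos q_μ). [cite: Balaban1983Higgs3, (3.28) p.441] -/
theorem lapSymbol_one_apply (q : Fin d → ℝ) : lapSymbol d 1 q = ∑ μ : Fin d, (2 - 2 * Real.cos (q μ)) := by
  simp [lapSymbol]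

/-- kernel: Δ¹ is continuous. [folklore] -/
private theorem continuous_lapSymbol' (d : ℕ) (ξ : ℝ) : Continuous (lapSymbol d ξ) := by
  unfold lapSymbol
  fun_prop

/-- **The tadpole in rescaled form**: C^ξ(0) = (2π)^{−d}·ξ²ξ^{−d}·∫_{|q|≤π} dq/(Δ¹(q) + ξ²), ξ > 0 — the change of
variables p = q/ξ of (3.24)/(3.28) applied to the momentum integral (3.16) at y = 0 (Δ^ξ(p) = ξ^{−2}Δ¹(ξp)).
[cite: Balaban1983Higgs3, (3.16) p.437] -/
theorem Cxi_zero_eq (hξ : 0 < ξ) :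
    Cxi d ξ 0 = (2 * Real.pi)⁻¹ ^ d * (ξ ^ 2 * (ξ ^ d)⁻¹) * ∫ q in bzBox d 1, 1 / (lapSymbol d 1 q + ξ ^ 2) := by
  unfold Cxi
  have hξ0 : ξ ≠ 0 := hξ.ne'
  have h1 : (fun p : Fin d → ℝ => Real.cos (ξ * ∑ μ : Fin d, p μ * (((0 : ZSite d) μ : ℤ) : ℝ)) / (lapSymbol d ξ p + 1)) =
      fun p => (fun q : Fin d → ℝ => ξ ^ 2 * (1 / (lapSymbol d 1 q + ξ ^ 2))) (ξ • p) := by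
    funext p
    have h0 : (∑ μ : Fin d, p μ * (((0 : ZSite d) μ : ℤ) : ℝ)) = 0 := by simp
    rw [h0, mul_zero, Real.cos_zero, lapSymbol_eq_smul ξ p]
    have hL : 0 ≤ lapSymbol d 1 (ξ • p) := lapSymbol_nonneg d 1 _
    have hA : ξ⁻¹ ^ 2 * lapSymbol d 1 (ξ • p) + 1 ≠ 0 := by positivity
    have hB : lapSymbol d 1 (ξ • p) + ξ ^ 2 ≠ 0 := by positivity
    field_simp
  rw [h1, integral_bzBox_comp_smul hξ (fun q => ξ ^ 2 * (1 / (lapSymbol d 1 q + ξ ^ 2))), integral_const_mul]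
  ring

/-! ## 2. Jordan's inequality: Δ¹(q) ≥ (4/π²)‖q‖²_∞ on the Brillouin box -/

/-- kernel (Jordan's inequality in half-angle form): (4/π²)t² ≤ 2 − 2cos t for |t| ≤ π
(2 − 2cos t = 4sin²(t/2) and sin x ≥ (2/π)x on [0, π/2]). [folklore] -/
private theorem sq_le_two_sub_two_cos {t : ℝ} (ht : |t| ≤ Real.pi) : 4 / Real.pi ^ 2 * t ^ 2 ≤ 2 - 2 * Real.cos t := by
  have hhalf : 2 - 2 * Real.cos t = 4 * Real.sin (t / 2) ^ 2 := by
    have h := Real.sin_sq_eq_half_sub (t / 2)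
    rw [show 2 * (t / 2) = t by ring] at h
    rw [h]
    ring
  have habs : Real.sin (t / 2) ^ 2 = Real.sin (|t| / 2) ^ 2 := by
    rcases abs_choice t with h | h
    · rw [h]
    · rw [h, neg_div, Real.sin_neg, neg_sq]
  have h0 : 0 ≤ |t| / 2 := by positivity
  have h1 : |t| / 2 ≤ Real.pi / 2 := by linarith
  have hj : 2 / Real.pi * (|t| / 2) ≤ Real.sin (|t| / 2) := Real.mul_le_sin h0 h1
  have hj0 : 0 ≤ 2 / Real.pi * (|t| / 2) := by positivity
  have hsq : (2 / Real.pi * (|t| / 2)) ^ 2 ≤ Real.sin (|t| / 2) ^ 2 := pow_le_pow_left₀ hj0 hj 2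
  have hre : (2 / Real.pi * (|t| / 2)) ^ 2 = t ^ 2 / Real.pi ^ 2 := by
    rw [show 2 / Real.pi * (|t| / 2) = |t| / Real.pi by ring, div_pow, sq_abs]
  rw [hhalf, habs]
  rw [hre] at hsq
  have hπ : 0 < Real.pi ^ 2 := by positivity
  calc 4 / Real.pi ^ 2 * t ^ 2 = 4 * (t ^ 2 / Real.pi ^ 2) := by ring
    _ ≤ 4 * Real.sin (|t| / 2) ^ 2 := by linarith

/-- kernel: the square of the sup norm is at most the sum of the squares of the coordinates. [folklore] -/
private theorem norm_sq_le_sum_sq (q : Fin d → ℝ) : ‖q‖ ^ 2 ≤ ∑ μ : Fin d, q μ ^ 2 := by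
  have hS : 0 ≤ ∑ μ : Fin d, q μ ^ 2 := Finset.sum_nonneg fun μ _ => sq_nonneg _
  have hle : ‖q‖ ≤ Real.sqrt (∑ μ : Fin d, q μ ^ 2) := by
    refine (pi_norm_le_iff_of_nonneg (Real.sqrt_nonneg _)).2 fun μ => ?_
    rw [Real.norm_eq_abs]
    exact Real.abs_le_sqrt (Finset.single_le_sum (fun κ _ => sq_nonneg (q κ)) (Finset.mem_univ μ))
  calc ‖q‖ ^ 2 ≤ Real.sqrt (∑ μ : Fin d, q μ ^ 2) ^ 2 := pow_le_pow_left₀ (norm_nonneg _) hle 2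
    _ = ∑ μ : Fin d, q μ ^ 2 := Real.sq_sqrt hS

/-- **Jordan bound for the lattice dispersion**: Δ¹(q) ≥ (4/π²)‖q‖² (sup norm) for every q of the Brillouin box
max_μ|q_μ| ≤ π. [cite: Balaban1983Higgs3, (3.28) p.441] -/
theorem norm_sq_le_lapSymbol {q : Fin d → ℝ} (hq : q ∈ bzBox d 1) : 4 / Real.pi ^ 2 * ‖q‖ ^ 2 ≤ lapSymbol d 1 q := by
  rw [lapSymbol_one_apply]
  have hq' : ∀ μ : Fin d, |q μ| ≤ Real.pi := by
    intro μ
    have h := hq μ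
    rwa [div_one] at h
  calc 4 / Real.pi ^ 2 * ‖q‖ ^ 2 ≤ 4 / Real.pi ^ 2 * ∑ μ : Fin d, q μ ^ 2 := by
        gcongr
        exact norm_sq_le_sum_sq q
    _ = ∑ μ : Fin d, 4 / Real.pi ^ 2 * q μ ^ 2 := Finset.mul_sum _ _ _
    _ ≤ ∑ μ : Fin d, (2 - 2 * Real.cos (q μ)) := Finset.sum_le_sum fun μ _ => sq_le_two_sub_two_cos (hq' μ)

/-- kernel: hence the integrand of the tadpole is majorised by the radial function 1/((4/π²)‖q‖² + ξ²) on the box.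
[folklore] -/
private theorem inv_lapSymbol_add_le (hξ : 0 < ξ) {q : Fin d → ℝ} (hq : q ∈ bzBox d 1) :
    1 / (lapSymbol d 1 q + ξ ^ 2) ≤ 1 / (4 / Real.pi ^ 2 * ‖q‖ ^ 2 + ξ ^ 2) :=
  one_div_le_one_div_of_le (by positivity) (by linarith [norm_sq_le_lapSymbol hq])

/-- kernel: the Brillouin box |q_μ| ≤ π lies in the open sup-norm ball of radius π + 1. [folklore] -/
private theorem bzBox_one_subset_ball : bzBox d 1 ⊆ Metric.ball (0 : Fin d → ℝ) (Real.pi + 1) := by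
  intro q hq
  rw [mem_ball_zero_iff]
  have hq' : ∀ μ : Fin d, |q μ| ≤ Real.pi := by
    intro μ
    have h := hq μ
    rwa [div_one] at h
  have h : ‖q‖ ≤ Real.pi :=
    (pi_norm_le_iff_of_nonneg Real.pi_pos.le).2 fun μ => by rw [Real.norm_eq_abs]; exact hq' μ
  linarith

/-! ## 3. The radial majorant -/

/-- kernel: the radial function is continuous (ξ > 0). [folklore] -/
private theorem continuous_radial (hξ : 0 < ξ) :
    Continuous fun q : Fin d → ℝ => 1 / (4 / Real.pi ^ 2 * ‖q‖ ^ 2 + ξ ^ 2) := by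
  have h : ∀ q : Fin d → ℝ, 4 / Real.pi ^ 2 * ‖q‖ ^ 2 + ξ ^ 2 ≠ 0 := fun q => by positivity
  exact continuous_const.div (by fun_prop) h

/-- kernel: the tadpole integrand is continuous (ξ > 0). [folklore] -/
private theorem continuous_invLap (hξ : 0 < ξ) :
    Continuous fun q : Fin d → ℝ => 1 / (lapSymbol d 1 q + ξ ^ 2) := by
  have h : ∀ q : Fin d → ℝ, lapSymbol d 1 q + ξ ^ 2 ≠ 0 := fun q => by
    have := lapSymbol_nonneg d 1 q
    positivity
  exact continuous_const.div ((continuous_lapSymbol' d 1).add continuous_const) h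

/-- kernel (polar coordinates for the sup norm): ∫_{‖q‖<π+1} dq/((4/π²)‖q‖² + ξ²) = d·2^d·∫₀^{π+1} y^{d−1}dy/((4/π²)y² + ξ²)
— Mathlib's `integral_fun_norm_addHaar`, the sup-norm unit ball of ℝ^d having Lebesgue volume 2^d. [folklore] -/
private theorem integral_ball_radial (hd : 0 < d) (ξ : ℝ) :
    ∫ q in Metric.ball (0 : Fin d → ℝ) (Real.pi + 1), 1 / (4 / Real.pi ^ 2 * ‖q‖ ^ 2 + ξ ^ 2) =
      (d : ℝ) * 2 ^ d * ∫ y in Set.Ioo 0 (Real.pi + 1), y ^ (d - 1) * (1 / (4 / Real.pi ^ 2 * y ^ 2 + ξ ^ 2)) := by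
  haveI : Nontrivial (Fin d → ℝ) := by
    haveI : Nonempty (Fin d) := ⟨⟨0, hd⟩⟩
    infer_instance
  set g : ℝ → ℝ := fun y => if y < Real.pi + 1 then 1 / (4 / Real.pi ^ 2 * y ^ 2 + ξ ^ 2) else 0 with hg
  have h1 : (fun q : Fin d → ℝ => g ‖q‖) =
      (Metric.ball (0 : Fin d → ℝ) (Real.pi + 1)).indicator fun q => 1 / (4 / Real.pi ^ 2 * ‖q‖ ^ 2 + ξ ^ 2) := by
    funext q
    by_cases hq : ‖q‖ < Real.pi + 1
    · rw [Set.indicator_of_mem (mem_ball_zero_iff.2 hq)]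
      simp [hg, hq]
    · rw [Set.indicator_of_notMem (fun h => hq (mem_ball_zero_iff.1 h))]
      simp [hg, hq]
  have h2 := MeasureTheory.integral_fun_norm_addHaar (volume : Measure (Fin d → ℝ)) g
  rw [h1, integral_indicator measurableSet_ball] at h2
  refine h2.trans ?_
  have hdim : Module.finrank ℝ (Fin d → ℝ) = d := by simp
  have hvol : (volume : Measure (Fin d → ℝ)).real (Metric.ball 0 1) = 2 ^ d := by
    rw [measureReal_def, Real.volume_pi_ball 0 one_pos, ENNReal.toReal_ofReal (by positivity)]
    simp
  have h3 : (fun y : ℝ => y ^ (Module.finrank ℝ (Fin d → ℝ) - 1) • g y) =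
      (Set.Iio (Real.pi + 1)).indicator fun y => y ^ (d - 1) * (1 / (4 / Real.pi ^ 2 * y ^ 2 + ξ ^ 2)) := by
    funext y
    rw [hdim, smul_eq_mul]
    by_cases hy : y < Real.pi + 1
    · rw [Set.indicator_of_mem (Set.mem_Iio.2 hy)]
      simp [hg, hy]
    · rw [Set.indicator_of_notMem (fun h => hy (Set.mem_Iio.1 h))]
      simp [hg, hy]
  rw [h3, setIntegral_indicator measurableSet_Iio, Set.Ioi_inter_Iio, hdim, hvol]
  simp only [nsmul_eq_mul, smul_eq_mul]
  ring

/-- **The radial majorant of the tadpole integral** (d ≥ 1, ξ > 0):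
∫_{|q|≤π} dq/(Δ¹(q) + ξ²) ≤ d·2^d·∫₀^{π+1} y^{d−1}dy/((4/π²)y² + ξ²) — Jordan's bound on the box, the box inside the
sup-norm ball of radius π + 1, polar coordinates. [cite: BalabanImbrieJaffe1985, (1.3) p.300] -/
theorem boxIntegral_le_radial (hd : 0 < d) (hξ : 0 < ξ) :
    ∫ q in bzBox d 1, 1 / (lapSymbol d 1 q + ξ ^ 2) ≤
      (d : ℝ) * 2 ^ d * ∫ y in Set.Ioo 0 (Real.pi + 1), y ^ (d - 1) * (1 / (4 / Real.pi ^ 2 * y ^ 2 + ξ ^ 2)) := by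
  rw [← integral_ball_radial hd ξ]
  have hN := continuous_radial (d := d) hξ
  calc ∫ q in bzBox d 1, 1 / (lapSymbol d 1 q + ξ ^ 2)
      ≤ ∫ q in bzBox d 1, 1 / (4 / Real.pi ^ 2 * ‖q‖ ^ 2 + ξ ^ 2) :=
        setIntegral_mono_on ((continuous_invLap hξ).continuousOn.integrableOn_compact (isCompact_bzBox' d 1))
          (hN.continuousOn.integrableOn_compact (isCompact_bzBox' d 1)) (measurableSet_bzBox' d 1)
          fun q hq => inv_lapSymbol_add_le hξ hq
    _ ≤ ∫ q in Metric.ball (0 : Fin d → ℝ) (Real.pi + 1), 1 / (4 / Real.pi ^ 2 * ‖q‖ ^ 2 + ξ ^ 2) :=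
        setIntegral_mono_set
          ((hN.continuousOn.integrableOn_compact (isCompact_closedBall 0 (Real.pi + 1))).mono_set ball_subset_closedBall)
          (ae_of_all _ fun q => by positivity) bzBox_one_subset_ball.eventuallyLE

/-! ## 4. d = 3: C^ξ(0) = O(ξ^{−1}) -/

/-- kernel: the one-dimensional integral for d = 3 is at most (π + 1)·π²/4 (the integrand y²/((4/π²)y² + ξ²) is ≤ π²/4).
[folklore] -/
private theorem radial_integral_three_le (hξ : 0 < ξ) :
    ∫ y in Set.Ioo 0 (Real.pi + 1), y ^ (3 - 1) * (1 / (4 / Real.pi ^ 2 * y ^ 2 + ξ ^ 2)) ≤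
      (Real.pi + 1) * (Real.pi ^ 2 / 4) := by
  have hR : (0 : ℝ) ≤ Real.pi + 1 := by positivity
  have hcont : Continuous fun y : ℝ => y ^ (3 - 1) * (1 / (4 / Real.pi ^ 2 * y ^ 2 + ξ ^ 2)) := by
    have h : ∀ y : ℝ, 4 / Real.pi ^ 2 * y ^ 2 + ξ ^ 2 ≠ 0 := fun y => by positivity
    exact (continuous_pow _).mul (continuous_const.div (by fun_prop) h)
  have hint : IntegrableOn (fun y : ℝ => y ^ (3 - 1) * (1 / (4 / Real.pi ^ 2 * y ^ 2 + ξ ^ 2)))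
      (Set.Ioo 0 (Real.pi + 1)) :=
    (hcont.continuousOn.integrableOn_Icc).mono_set Set.Ioo_subset_Icc_self
  have hconst : IntegrableOn (fun _ : ℝ => Real.pi ^ 2 / 4) (Set.Ioo 0 (Real.pi + 1)) :=
    (continuous_const.continuousOn.integrableOn_Icc).mono_set Set.Ioo_subset_Icc_self
  calc ∫ y in Set.Ioo 0 (Real.pi + 1), y ^ (3 - 1) * (1 / (4 / Real.pi ^ 2 * y ^ 2 + ξ ^ 2))
      ≤ ∫ _ in Set.Ioo 0 (Real.pi + 1), Real.pi ^ 2 / 4 := by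
        refine setIntegral_mono_on hint hconst measurableSet_Ioo fun y _ => ?_
        have hD : 0 < 4 / Real.pi ^ 2 * y ^ 2 + ξ ^ 2 := by positivity
        rw [mul_one_div, div_le_iff₀ hD]
        have hπ : 0 < Real.pi ^ 2 := by positivity
        have h1 : Real.pi ^ 2 / 4 * (4 / Real.pi ^ 2 * y ^ 2 + ξ ^ 2) = y ^ 2 + Real.pi ^ 2 / 4 * ξ ^ 2 := by
          field_simp
        rw [h1]
        nlinarith [sq_nonneg ξ, Real.pi_pos]
    _ = (Real.pi + 1) * (Real.pi ^ 2 / 4) := by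
        rw [setIntegral_const, Real.volume_real_Ioo_of_le hR, smul_eq_mul, sub_zero]

/-- **(1.3), d = 3, one-loop content — C^ξ(0) = O(ξ^{−1})**: for every ξ > 0,
0 ≤ C^ξ(0) ≤ (3(π+1)/(4π))·ξ^{−1} (the free tadpole of the unit-mass propagator (3.16) on ξℤ³ diverges at most
linearly in ξ^{−1}; lower bound `B3CxiPropagator.Cxi_nonneg`). [cite: BalabanImbrieJaffe1985, (1.3) p.300] -/
theorem Cxi_zero_le_three (hξ : 0 < ξ) : Cxi 3 ξ 0 ≤ 3 * (Real.pi + 1) / (4 * Real.pi) * ξ⁻¹ := by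
  rw [Cxi_zero_eq hξ]
  have hI := boxIntegral_le_radial (d := 3) (by norm_num) hξ
  have hJ := radial_integral_three_le hξ
  have hpos : 0 ≤ (2 * Real.pi)⁻¹ ^ 3 * (ξ ^ 2 * (ξ ^ 3)⁻¹) := by positivity
  have hI' : ∫ q in bzBox 3 1, 1 / (lapSymbol 3 1 q + ξ ^ 2) ≤ (3 : ℕ) * 2 ^ 3 * ((Real.pi + 1) * (Real.pi ^ 2 / 4)) :=
    hI.trans (by gcongr)
  calc (2 * Real.pi)⁻¹ ^ 3 * (ξ ^ 2 * (ξ ^ 3)⁻¹) * ∫ q in bzBox 3 1, 1 / (lapSymbol 3 1 q + ξ ^ 2)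
      ≤ (2 * Real.pi)⁻¹ ^ 3 * (ξ ^ 2 * (ξ ^ 3)⁻¹) * ((3 : ℕ) * 2 ^ 3 * ((Real.pi + 1) * (Real.pi ^ 2 / 4))) :=
        mul_le_mul_of_nonneg_left hI' hpos
    _ = 3 * (Real.pi + 1) / (4 * Real.pi) * ξ⁻¹ := by
        have hπ : Real.pi ≠ 0 := Real.pi_pos.ne'
        have hξ0 : ξ ≠ 0 := hξ.ne'
        push_cast
        field_simp

/-- kernel: the two-sided form 0 ≤ C^ξ(0) ≤ Kξ^{−1} in d = 3. [cite: BalabanImbrieJaffe1985, (1.3) p.300] -/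
theorem Cxi_zero_mem_Icc_three (hξ : 0 < ξ) :
    Cxi 3 ξ 0 ∈ Set.Icc 0 (3 * (Real.pi + 1) / (4 * Real.pi) * ξ⁻¹) :=
  ⟨Cxi_nonneg hξ 0, Cxi_zero_le_three hξ⟩

/-- **(1.3), d = 3, as printed — "O(ε^{−1}) (d = 3)"** for the one-loop (tadpole) term: there is a constant K with
C^ξ(0) ≤ Kξ^{−1} for all ξ > 0. [cite: BalabanImbrieJaffe1985, (1.3) p.300] -/
theorem tadpole_bigO_three : ∃ K : ℝ, ∀ ξ : ℝ, 0 < ξ → Cxi 3 ξ 0 ≤ K * ξ⁻¹ :=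
  ⟨3 * (Real.pi + 1) / (4 * Real.pi), fun _ hξ => Cxi_zero_le_three hξ⟩

/-! ## 5. d = 2: C^ξ(0) = O(log ξ^{−1}) -/

/-- kernel: the one-dimensional integral for d = 2 in closed form,
∫₀^{π+1} y dy/((4/π²)y² + ξ²) = (π²/8)(log((4/π²)(π+1)² + ξ²) − log ξ²) (fundamental theorem of calculus). [folklore] -/
private theorem radial_integral_two_eq (hξ : 0 < ξ) :
    ∫ y in Set.Ioo 0 (Real.pi + 1), y ^ (2 - 1) * (1 / (4 / Real.pi ^ 2 * y ^ 2 + ξ ^ 2)) =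
      Real.pi ^ 2 / 8 * (Real.log (4 / Real.pi ^ 2 * (Real.pi + 1) ^ 2 + ξ ^ 2) - Real.log (ξ ^ 2)) := by
  have hR : (0 : ℝ) ≤ Real.pi + 1 := by positivity
  rw [← integral_Ioc_eq_integral_Ioo, ← intervalIntegral.integral_of_le hR]
  have hden : ∀ y : ℝ, 0 < 4 / Real.pi ^ 2 * y ^ 2 + ξ ^ 2 := fun y => by positivity
  have hF : ∀ y ∈ Set.uIcc 0 (Real.pi + 1),
      HasDerivAt (fun y : ℝ => Real.pi ^ 2 / 8 * Real.log (4 / Real.pi ^ 2 * y ^ 2 + ξ ^ 2))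
        (y ^ (2 - 1) * (1 / (4 / Real.pi ^ 2 * y ^ 2 + ξ ^ 2))) y := by
    intro y _
    have h1 : HasDerivAt (fun y : ℝ => 4 / Real.pi ^ 2 * y ^ 2 + ξ ^ 2) (4 / Real.pi ^ 2 * (2 * y)) y := by
      have h := ((hasDerivAt_pow 2 y).const_mul (4 / Real.pi ^ 2)).add_const (ξ ^ 2)
      simpa using h
    have h2 := (h1.log (hden y).ne').const_mul (Real.pi ^ 2 / 8)
    have hπ : Real.pi ^ 2 ≠ 0 := by positivity
    have h3 : Real.pi ^ 2 / 8 * (4 / Real.pi ^ 2 * (2 * y) / (4 / Real.pi ^ 2 * y ^ 2 + ξ ^ 2)) =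
        y ^ (2 - 1) * (1 / (4 / Real.pi ^ 2 * y ^ 2 + ξ ^ 2)) := by
      rw [show (2 : ℕ) - 1 = 1 from rfl, pow_one, mul_one_div, mul_div_assoc', div_eq_div_iff (hden y).ne' (hden y).ne']
      field_simp
      ring
    rw [h3] at h2
    exact h2
  have hcont : Continuous fun y : ℝ => y ^ (2 - 1) * (1 / (4 / Real.pi ^ 2 * y ^ 2 + ξ ^ 2)) :=
    (continuous_pow _).mul (continuous_const.div (by fun_prop) fun y => (hden y).ne')
  rw [intervalIntegral.integral_eq_sub_of_hasDerivAt hF (hcont.intervalIntegrable _ _)]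
  simp only [ne_eq, OfNat.ofNat_ne_zero, not_false_eq_true, zero_pow, mul_zero, zero_add]
  ring

/-- **(1.3), d = 2, one-loop content — C^ξ(0) = O(log ξ^{−1})**: for every ξ > 0,
C^ξ(0) ≤ ¼·log(1 + 4(π+1)²/(π²ξ²)) (the free tadpole of the unit-mass propagator (3.16) on ξℤ² diverges at most
logarithmically). [cite: BalabanImbrieJaffe1985, (1.3) p.300] -/
theorem Cxi_zero_le_two (hξ : 0 < ξ) :
    Cxi 2 ξ 0 ≤ 1 / 4 * Real.log (1 + 4 * (Real.pi + 1) ^ 2 / (Real.pi ^ 2 * ξ ^ 2)) := by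
  rw [Cxi_zero_eq hξ]
  have hI := boxIntegral_le_radial (d := 2) (by norm_num) hξ
  rw [radial_integral_two_eq hξ] at hI
  have hξ2 : 0 < ξ ^ 2 := by positivity
  have hnum : 0 < 4 / Real.pi ^ 2 * (Real.pi + 1) ^ 2 + ξ ^ 2 := by positivity
  have hlog : Real.log (4 / Real.pi ^ 2 * (Real.pi + 1) ^ 2 + ξ ^ 2) - Real.log (ξ ^ 2) =
      Real.log (1 + 4 * (Real.pi + 1) ^ 2 / (Real.pi ^ 2 * ξ ^ 2)) := by
    rw [← Real.log_div hnum.ne' hξ2.ne']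
    congr 1
    have hπ : Real.pi ^ 2 ≠ 0 := by positivity
    field_simp
    ring
  rw [hlog] at hI
  have hpos : 0 ≤ (2 * Real.pi)⁻¹ ^ 2 * (ξ ^ 2 * (ξ ^ 2)⁻¹) := by positivity
  calc (2 * Real.pi)⁻¹ ^ 2 * (ξ ^ 2 * (ξ ^ 2)⁻¹) * ∫ q in bzBox 2 1, 1 / (lapSymbol 2 1 q + ξ ^ 2)
      ≤ (2 * Real.pi)⁻¹ ^ 2 * (ξ ^ 2 * (ξ ^ 2)⁻¹) *
          ((2 : ℕ) * 2 ^ 2 * (Real.pi ^ 2 / 8 * Real.log (1 + 4 * (Real.pi + 1) ^ 2 / (Real.pi ^ 2 * ξ ^ 2)))) :=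
        mul_le_mul_of_nonneg_left hI hpos
    _ = 1 / 4 * Real.log (1 + 4 * (Real.pi + 1) ^ 2 / (Real.pi ^ 2 * ξ ^ 2)) := by
        have hπ : Real.pi ≠ 0 := Real.pi_pos.ne'
        have hξ0 : ξ ≠ 0 := hξ.ne'
        push_cast
        field_simp
        ring

/-- **(1.3), d = 2 — the printed form "O(ln ε^{−1}) (d = 2)"** with explicit constants: for 0 < ξ ≤ 1,
C^ξ(0) ≤ ¼log(1 + 4(π+1)²/π²) + ½log ξ^{−1}. [cite: BalabanImbrieJaffe1985, (1.3) p.300] -/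
theorem Cxi_zero_le_two_log (hξ : 0 < ξ) (hξ1 : ξ ≤ 1) :
    Cxi 2 ξ 0 ≤ 1 / 4 * Real.log (1 + 4 * (Real.pi + 1) ^ 2 / Real.pi ^ 2) + 1 / 2 * Real.log ξ⁻¹ := by
  refine (Cxi_zero_le_two hξ).trans ?_
  have hξ2 : 0 < ξ ^ 2 := by positivity
  have hc : 0 < 4 * (Real.pi + 1) ^ 2 / Real.pi ^ 2 := by positivity
  -- 1 + c/ξ² ≤ (1 + c)/ξ² for ξ ≤ 1, then log((1+c)/ξ²) = log(1+c) + 2 log ξ⁻¹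
  have hξ2le : ξ ^ 2 ≤ 1 := by nlinarith
  have hstep : 1 + 4 * (Real.pi + 1) ^ 2 / (Real.pi ^ 2 * ξ ^ 2) ≤ (1 + 4 * (Real.pi + 1) ^ 2 / Real.pi ^ 2) / ξ ^ 2 := by
    rw [add_div, div_div]
    gcongr
    rw [le_div_iff₀ hξ2]
    linarith
  have hlog : Real.log (1 + 4 * (Real.pi + 1) ^ 2 / (Real.pi ^ 2 * ξ ^ 2)) ≤
      Real.log (1 + 4 * (Real.pi + 1) ^ 2 / Real.pi ^ 2) + 2 * Real.log ξ⁻¹ := by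
    have h1 : 0 < 1 + 4 * (Real.pi + 1) ^ 2 / (Real.pi ^ 2 * ξ ^ 2) := by positivity
    refine (Real.log_le_log h1 hstep).trans_eq ?_
    rw [Real.log_div (by positivity) hξ2.ne', Real.log_inv, Real.log_pow]
    push_cast
    ring
  linarith

/-- **(1.3), d = 2, as printed — "O(ln ε^{−1}) (d = 2)"** for the one-loop (tadpole) term: there are constants A, B with
C^ξ(0) ≤ A + B·log ξ^{−1} for all 0 < ξ ≤ 1. [cite: BalabanImbrieJaffe1985, (1.3) p.300] -/
theorem tadpole_bigO_two : ∃ A B : ℝ, ∀ ξ : ℝ, 0 < ξ → ξ ≤ 1 → Cxi 2 ξ 0 ≤ A + B * Real.log ξ⁻¹ :=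
  ⟨1 / 4 * Real.log (1 + 4 * (Real.pi + 1) ^ 2 / Real.pi ^ 2), 1 / 2, fun _ hξ hξ1 => Cxi_zero_le_two_log hξ hξ1⟩

end Literature.MathematicalPhysics.QuantumFieldTheory.Balaban1983to89.B3CxiTadpole

end
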